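import Summits.QuantumFields.YangMills.Theorems.BalabanUVNodesN18HLayerW1TwoRadiiTerms
import Literature.MathematicalPhysics.QuantumFieldTheory.Balaban1983to89.Node00.HistoryTermDatum214

/-!
# BalabanUVNodes ∕ N18 — THE H-LAYER CHAIN AT node00-def-W1's (2.14) TERM DATUM `W1.TermData214`: (T-226) DISCHARGED PER TERM, ALONG THE
# HISTORY, BY `TermDatum214.norm_TF_le_weight_of_primitives` FROM THE LOCATED INPUTS; files 23 ∕ 24 AT `T := 𝔇.TF`, i.e. AT THE GENERATOR
# `𝔇.Gn = GenTower.ofTerms L 𝔇.TF` (Track A, DAG node N18 = NE5 `T4OutputRate.NE5 EA EB W κ θ C₅` :211; cluster K4 «SpineRates»; file 25 of seat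
# pub-ymgap-dag-n18-c, row s1 «the H-layer activity datum on the record's torus catalogue», generation 5; node00-def-W1 g7's consumer recipe W1-7)

Cell `pub-ymgap`, HUMAN RULING D-0062 (Track A), R134 seat `pub-ymgap-dag-n18-c` (s1), generation 5.  THEOREMS ONLY (no `def`, no `instance`, no
`sorry`); imports file 24 `…N18HLayerW1TwoRadiiTerms` (through it files 22 ∕ 23 and W1's `Node00/HistoryTermIndexedGenerator`) and W1's STOREY 7
`Node00/HistoryTermDatum214` (`W1.TermDatum214`, `TermData214.TF ∕ Gn`, `TermDatum214.norm_TF_le_weight_of_primitives`); restates nothing.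

WHY.  File 23 reduced N18's configuration-direction obligation for a term-indexed generator `GenTower.ofTerms L T` to TWO per-term schemas: (T-an) —
(2.14) analytic in the configuration on the table — and (T-226) — `‖T k Z (𝐃,P) g old φ‖ ≤ weight L M c Z a (𝐃,P)·e^{a₅|Z|}` on the table ([II] (2.26)
p. 17).  node00-def-W1's STOREY 7 declares THE (2.14) TERM DATUM `𝔇 : W1.TermData214 c P 𝔸 M L` (NODE A's kernel record `𝒦 Z t` per term, the
configuration reading `uOf`, the Cauchy radius, the characteristic functions of (2.3) at the coupling, Lemma 2's potentials `𝒱` READ FROM THE HISTORY),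
DEFINES the term functional `𝔇.TF` = print's display (2.14) and the generator `𝔇.Gn := GenTower.ofTerms L 𝔇.TF`, and proves `norm_TF_le_weight_of_primitives`:
(2.26) for ONE term of the datum from the LOCATED primitive inputs (`B13Lemma3TorusPrimitive.h226_torus_of_primitives` by name), whose conclusion is
byte-for-byte file 23's (T-226) binder.  THIS FILE applies it ALONG THE HISTORY — for every step `k`, every coupling `g ∈ D`, every older-term table in
the class «(1.18)`(E₀,r₁)` on the tables `sp j` + analytic there», every `Z`, every configuration of the located-inputs table `big (k+1) Z` (print's
analyticity space with the LARGER radii `α′₀, α′₁`, [II] p. 15) and every term `(𝐃,P) ∈ terms L M Z` — so that (T-226) for `𝔇.TF` is DISCHARGED from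
the located inputs quantified along the history (§1), and files 23 ∕ 24 run at `T := 𝔇.TF` with (T-an) as the ONE remaining analytic binder (§2):
W1's `RecAdmissible`, the (2.38) pair at every step, (1.18) for the generated tower, on one table (`sp (k+1) Z ⊆ big (k+1) Z`) and on print's table pair.
THE INDUCTION IS VISIBLE: the (2.20) input `h220R` for the datum's potentials `𝒱(g, old, φ)` is guarded by «old satisfies (1.18)`(E₀,r₁)` on the tables»
— exactly Lemma 2's hypothesis ([II] (1.41) p. 11 from [I] (1.18)) — and W1's `RecAdmissible` returns the generated older terms to that class.

WHAT (theorems only; coefficient algebra `𝔸 : Type`; `P := F.P K`; one `B13.Consts` letter `c` for the datum's kernels, the weights and Lemma 3).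
* §1 `termwise226_TF_of_located` — ★ (T-226) FOR `𝔇.TF` ALONG THE HISTORY on the table `big`, from: the τ-radii conditions of (2.18) (`hpos hhalf hUtau`),
  the Cauchy data (`hUσ hUτ hUexp hr hr' hsubτ`), the signs and the (2.22) shape of `χχᶜ` at the couplings of `D` (`hχ0 hχc0 h222`, `qP ≤ B·B`), separate
  analyticity of the X-integral (`hΨσ hΨτ`) and Lemma 2's (2.20) shape of `𝒱` (`h220R`) along the history, NODE A at the configuration: symmetry ∕ `Re ≻ 0`
  of the precision (`hAs hA`), (L17a) `Localisation17a` and (L16a) `Differences216` BY NAME (`hL17 hL16` — the conclusions of NODE A's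
  `localisation17a_of_termWalkData` ∕ `differences216_of_termWalkData`), the column fibre bound, and the numerics of (2.24)–(2.26) per term (`hθR1le hsmallKθ
  hc hαc hΓq hsm25 hvol`) with uniform constants.  Proof: one application of W1's §4 theorem per term.
* §2 AT THE GENERATOR `𝔇.Gn` (`= GenTower.ofTerms L 𝔇.TF`, `TermData214.Gn_eq`): `stepGen_Gn_of_located` ((GEN): activities analytic + (2.38)-bounded, file 23
  `stepGen_ofTerms_of_termwise`), `recAdmissible_Gn_of_located` (W1's `RecAdmissible`), `hLayer_toClusterTower_Gn_of_located` (the (2.38) pair on the boxes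
  `]0,γ]^{k+1}`), `termBound118_toClusterTower_Gn_of_located` ((1.18) for the generated tower), and on print's table pair `recAdmissible_Gn_of_located₂` (file 24:
  older terms on `sp`, the step on `sp′`, clause `Z ⊆ X ⇒ sp X ⊆ sp′ Z`, `sp′ ⊆ big`).  The witness-numerals faces (file 23 `…_consts`, file 24
  `recAdmissible_ofTerms_of_termwise₂_consts`) and L05 at the pairing of record (file 23 `decayBound_EA_ofRecordAdm_ofTerms_of_termwise`, `𝔸 := M_N(ℂ)`)
  apply verbatim with `T := 𝔇.TF` and `hT226 :=` §1.

HONEST FRAMING — what this is NOT.  Instantiation only: §1 is ONE application per term of W1's kernel-checked §4 theorem (itself one application of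
`h226_torus_of_primitives`), §2 are files 23 ∕ 24 at `T := 𝔇.TF`; NO estimate is proved here.  DISPLAYED, not discharged: the datum is DATA (Lemma 2's
reading (1.33)–(1.41) of `𝒱` and NODE A's kernels of record are the later programme — node00-def-B13 TERM-TOWER-CENSUS); the located inputs of §1 —
in particular (2.20) for `𝒱` along the history = [II] LEMMA 2, (2.22) = [II] (2.22), separate analyticity of the X-integral = [II] p. 15, (L17a)∕(L16a) at the
configuration = NODE A's capstones from `TermWalkData`, `Re A(σ,u) ≻ 0` = [II] p. 15 — and (T-an) = analyticity of the display (2.14) in the configuration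
(N10's holomorphy lane); the numerics.  Count-neutral; NOT a discharge of N18 (typed 28∕28 · discharged 5∕27 UNCHANGED); NE5 NOT IN PRINT ∕ NOT PROVED.
One finite four-torus programme at fixed `ε`, Bałaban as printed — NOT ℝ⁴, NOT infinite volume, NOT OS, NOT a mass gap, NOT Clay.  0 `sorry`, 0 `def`.

References (TYPES ∕ loci only): [II] = [Balaban1988RG2Cluster] CMP **116** (1988) — (1.41) p. 11, (2.3) p. 12, (2.9)–(2.11) p. 14, (2.14) p. 15 and the
analyticity statement p. 15, (2.16)–(2.22) p. 16, (2.23)–(2.26) p. 17, Lemma 3 (2.38) p. 20, (2.41) p. 21, p. 22; [I] = [Balaban1987RG1] CMP **109** (1987) —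
(1.18) p. 263, Thm 1 p. 259, (2.12)–(2.13) p. 268.
-/

noncomputable section

open scoped Classical

namespace Summit.QuantumFields.YangMills.BalabanUVNodes.N18HLayerW1TermDatum

open Set Metric
open scoped BigOperators Matrix Matrix.Norms.L2Operator
open Literature.MathematicalPhysics.QuantumFieldTheory.Balaban1983to89
open Literature.MathematicalPhysics.QuantumFieldTheory.Balaban1983to89.T4Continuum (T4Family)
open Literature.MathematicalPhysics.QuantumFieldTheory.Balaban1983to89.T4OutputRate
open Literature.MathematicalPhysics.QuantumFieldTheory.Balaban1983to89.TreeLengthTorus (TDom TPt tsys)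
open Literature.MathematicalPhysics.QuantumFieldTheory.Balaban1983to89.B12TreeDecay (K₀)
open Literature.MathematicalPhysics.QuantumFieldTheory.Balaban1983to89.B13Lemma3TorusTerms (terms weight)
open Literature.MathematicalPhysics.QuantumFieldTheory.Balaban1983to89.B13Lemma3TorusSocket (Lemma3Numerics)
open Literature.MathematicalPhysics.QuantumFieldTheory.Balaban1983to89.B13Term214 (SepHolOn)
open Literature.MathematicalPhysics.QuantumFieldTheory.Balaban1983to89.B13Bound143 (invTau)
open Literature.MathematicalPhysics.QuantumFieldTheory.Balaban1983to89.B9Thm37GlueTorus (tdist1)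
open Literature.MathematicalPhysics.QuantumFieldTheory.Balaban1983to89.B5TorusCover (UT)
open Literature.MathematicalPhysics.QuantumFieldTheory.Balaban1983to89.B13PrimitiveKernels216 (Localisation17a Differences216)
open Literature.MathematicalPhysics.QuantumFieldTheory.Balaban1983to89.Node00
open Literature.MathematicalPhysics.QuantumFieldTheory.Balaban1983to89.Node00.Sect2 (domSys domCount CPair)
open Literature.MathematicalPhysics.QuantumFieldTheory.Balaban1983to89.Node00.W1
open Summit.QuantumFields.YangMills.BalabanUVNodes.N18HLayerW1TermIndexed (stepGen_ofTerms_of_termwise recAdmissible_ofTerms_of_termwise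
  hLayer_toClusterTower_ofTerms_of_termwise termBound118_toClusterTower_ofTerms_of_termwise)
open Summit.QuantumFields.YangMills.BalabanUVNodes.N18HLayerW1TwoRadiiTerms (recAdmissible_ofTerms_of_termwise₂)

section Located

variable (F : T4Family) (K : ℕ) {𝔸 : Type} [NormedRing 𝔸] [NormedAlgebra ℂ 𝔸] {M : ℕ} [NeZero M] (L : ℕ) [NeZero L]
  {c : B13.Consts} (𝔇 : TermData214 c (F.P K) 𝔸 M L) (D : Set ℂ)
  (sp big : (j : ℕ) → (domSys (F.P K) M j).Dom → Set (CPair (F.P K) 𝔸)) {E₀ r₁ : ℝ}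
  -- the `B13.Consts` letters the (2.26) engine divides by
  (hκ₁ : 1 ≤ c.κ₁) (hα₆ : c.α₆ ≠ 0)
  -- (2.18): the τ-radii `|τ(Y)| = (invTau c (d_k Y))⁻¹ ≥ 2` on every fine torus of the catalogue
  (hpos : ∀ k : ℕ, ∀ Y : TDom (F.P K).d (L * domCount (F.P K) M (k + 1)),
    0 < invTau c ((tsys (F.P K).d (L * domCount (F.P K) M (k + 1))).dj Y))
  (hhalf : ∀ k : ℕ, ∀ Y : TDom (F.P K).d (L * domCount (F.P K) M (k + 1)),
    invTau c ((tsys (F.P K).d (L * domCount (F.P K) M (k + 1))).dj Y) ≤ 1 / 2)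
  -- the Cauchy data: analyticity domains in `σ`, `τ`, the polydisc `|σ| ≤ e^{κ₁}`, the τ-discs, the contour radius of the datum
  {Uσ Uτ : Set ℂ} (hUσ : IsOpen Uσ) (hUτ : IsOpen Uτ) (hUexp : closedBall (0 : ℂ) (Real.exp c.κ₁) ⊆ Uσ)
  (hUtau : ∀ k : ℕ, ∀ Y : TDom (F.P K).d (L * domCount (F.P K) M (k + 1)),
    closedBall (0 : ℂ) ((invTau c ((tsys (F.P K).d (L * domCount (F.P K) M (k + 1))).dj Y))⁻¹) ⊆ Uτ)
  (hr : ∀ k : ℕ, 0 < (𝔇 k).r) (hr' : ∀ k : ℕ, (𝔇 k).r ≤ Real.exp c.κ₁ - 1)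
  (hsubτ : ∀ k : ℕ, ∀ x ∈ Set.uIcc (0 : ℝ) 1, closedBall (x : ℂ) (𝔇 k).r ⊆ Uτ)
  -- (2.3) at the couplings of `D`: signs of `χ`, `χᶜ`
  (hχ0 : ∀ (k : ℕ) (Z : (domSys (F.P K) M (k + 1)).Dom) (t : TermLabel (F.P K) M k L), ∀ s ∈ D, ∀ B, 0 ≤ (𝔇 k).chiY₀ Z t s B)
  (hχc0 : ∀ (k : ℕ) (Z : (domSys (F.P K) M (k + 1)).Dom) (t : TermLabel (F.P K) M k L), ∀ s ∈ D, ∀ B, 0 ≤ (𝔇 k).chicP Z t s B)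
  -- [II] p. 15: separate analyticity of the X-integral in `σ(Δ)` and `τ(Y)`, along the history, on the located-inputs table
  (hΨσ : ∀ k : ℕ, ∀ s ∈ D, ∀ old : OlderTerms (F.P K) 𝔸 M k,
    (∀ (j : Fin (k + 1)) (Y : (domSys (F.P K) M j).Dom), ∀ ψ ∈ sp j Y,
        ‖old j Y ψ‖ ≤ E₀ * Real.exp (-(r₁ * (domSys (F.P K) M j).dj Y))) →
    (∀ (j : Fin (k + 1)) (Y : (domSys (F.P K) M j).Dom), AnalyticOnNhd ℂ (old j Y) (sp j Y)) →
    ∀ (Z : (domSys (F.P K) M (k + 1)).Dom), ∀ φ ∈ big (k + 1) Z, ∀ t ∈ terms L M Z,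
      ∀ τ : TDom (F.P K).d (L * domCount (F.P K) M (k + 1)) → ℂ, (∀ j, τ j ∈ Uτ) →
        SepHolOn Uσ (fun σ => (𝔇 k).core Z t s old φ σ τ))
  (hΨτ : ∀ k : ℕ, ∀ s ∈ D, ∀ old : OlderTerms (F.P K) 𝔸 M k,
    (∀ (j : Fin (k + 1)) (Y : (domSys (F.P K) M j).Dom), ∀ ψ ∈ sp j Y,
        ‖old j Y ψ‖ ≤ E₀ * Real.exp (-(r₁ * (domSys (F.P K) M j).dj Y))) →
    (∀ (j : Fin (k + 1)) (Y : (domSys (F.P K) M j).Dom), AnalyticOnNhd ℂ (old j Y) (sp j Y)) →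
    ∀ (Z : (domSys (F.P K) M (k + 1)).Dom), ∀ φ ∈ big (k + 1) Z, ∀ t ∈ terms L M Z,
      ∀ σ : TPt (F.P K).d (domCount (F.P K) M (k + 1)) → ℂ, (∀ j, σ j ∈ Uσ) →
        SepHolOn Uτ (fun τ => (𝔇 k).core Z t s old φ σ τ))
  -- NODE A ([II] p. 15): symmetry and `Re ≻ 0` of the precision `A(σ, u(φ))` on the polydisc, at the configurations of the table
  (hAs : ∀ (k : ℕ) (Z : (domSys (F.P K) M (k + 1)).Dom), ∀ φ ∈ big (k + 1) Z, ∀ t ∈ terms L M Z,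
    ∀ σ : TPt (F.P K).d (domCount (F.P K) M (k + 1)) → ℂ, (∀ j, ‖σ j‖ ≤ Real.exp c.κ₁) → ((𝔇 k).A Z t φ σ).IsSymm)
  (hA : ∀ (k : ℕ) (Z : (domSys (F.P K) M (k + 1)).Dom), ∀ φ ∈ big (k + 1) Z, ∀ t ∈ terms L M Z,
    ∀ σ : TPt (F.P K).d (domCount (F.P K) M (k + 1)) → ℂ, (∀ j, ‖σ j‖ ≤ Real.exp c.κ₁) →
      (((𝔇 k).A Z t φ σ).map Complex.re).PosDef)
  -- [II] (2.22) for `χχᶜ` at the couplings of `D` (quadratic forms `qP ≤ B·B`) and LEMMA 2's (2.20) for the potentials `𝒱` ALONG THE HISTORY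
  {γ₂ rP a₂₀ w : ℝ} (hγ₂ : 0 ≤ γ₂) (ha0 : 0 ≤ a₂₀)
  (qP : (k : ℕ) → (Z : (domSys (F.P K) M (k + 1)).Dom) → (t : TermLabel (F.P K) M k L) → (((𝔇 k).𝒦 Z t).Λ → ℝ) → ℝ)
  (hqP : ∀ (k : ℕ) (Z : (domSys (F.P K) M (k + 1)).Dom) (t : TermLabel (F.P K) M k L) (B : ((𝔇 k).𝒦 Z t).Λ → ℝ), qP k Z t B ≤ B ⬝ᵥ B)
  (h222 : ∀ (k : ℕ) (Z : (domSys (F.P K) M (k + 1)).Dom) (t : TermLabel (F.P K) M k L), ∀ s ∈ D, ∀ B : ((𝔇 k).𝒦 Z t).Λ → ℝ,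
    (𝔇 k).chiY₀ Z t s B * (𝔇 k).chicP Z t s B ≤ Real.exp (-(γ₂ / 2 * rP ^ 2 * (t.2.card : ℕ)) + γ₂ / 2 * qP k Z t B))
  (h220R : ∀ k : ℕ, ∀ s ∈ D, ∀ old : OlderTerms (F.P K) 𝔸 M k,
    (∀ (j : Fin (k + 1)) (Y : (domSys (F.P K) M j).Dom), ∀ ψ ∈ sp j Y,
        ‖old j Y ψ‖ ≤ E₀ * Real.exp (-(r₁ * (domSys (F.P K) M j).dj Y))) →
    (∀ (j : Fin (k + 1)) (Y : (domSys (F.P K) M j).Dom), AnalyticOnNhd ℂ (old j Y) (sp j Y)) →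
    ∀ (Z : (domSys (F.P K) M (k + 1)).Dom), ∀ φ ∈ big (k + 1) Z, ∀ t ∈ terms L M Z, ∀ B : ((𝔇 k).𝒦 Z t).Λ → ℝ,
      ∑ Y ∈ t.1, (invTau c ((tsys (F.P K).d (L * domCount (F.P K) M (k + 1))).dj Y))⁻¹ * ‖(𝔇 k).𝒱 Z t s old φ Y B‖ ≤
        a₂₀ / 2 * (B ⬝ᵥ B) + w)
  -- the column fibre bound of the kernel record's locations
  (hfibN : ∀ (k : ℕ) (Z : (domSys (F.P K) M (k + 1)).Dom) (t : TermLabel (F.P K) M k L) (x : UT (𝔇 k).Nf),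
    (Finset.univ.filter fun j => ((𝔇 k).𝒦 Z t).locN j = x).card ≤ ((𝔇 k).𝒦 Z t).m)
  -- rates and uniform constants
  {kap kap' kap'' θ θE θΓ θC KG KΓ KCs KC : ℝ} (hkap'' : 0 < kap'') (h1 : kap'' < kap') (h2 : kap' < kap)
  (hθE : 0 ≤ θE) (hθΓ : 0 ≤ θΓ) (hθC : 0 ≤ θC) (hKG : 0 ≤ KG) (hKΓ : 0 ≤ KΓ) (hKCs : 0 ≤ KCs) (hKC : 0 ≤ KC)
  (hθEle : θE ≤ θ) (hθΓle : θΓ ≤ θ)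
  (hθR1le : ∀ (k : ℕ) (Z : (domSys (F.P K) M (k + 1)).Dom) (t : TermLabel (F.P K) M k L),
    ((((𝔇 k).𝒦 Z t).m : ℝ) * (1 + 2 / (kap - kap')) ^ (𝔇 k).ν) * ((((𝔇 k).𝒦 Z t).m : ℝ) * (1 + 2 / (kap' - kap'')) ^ (𝔇 k).ν)
      * (θΓ * KCs * KG + KΓ * θC * KG + KΓ * KC * θΓ) ≤ θ)
  -- NODE A AT THE CONFIGURATION, BY NAME: (L17a) and (L16a) for the kernel record read at `u = uOf Z t φ`
  (hL17 : ∀ (k : ℕ) (Z : (domSys (F.P K) M (k + 1)).Dom), ∀ φ ∈ big (k + 1) Z, ∀ t ∈ terms L M Z,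
    Localisation17a c (fun σ => ((𝔇 k).𝒦 Z t).A2 σ ((𝔇 k).uOf Z t φ)) (fun σ => ((𝔇 k).𝒦 Z t).G2 σ ((𝔇 k).uOf Z t φ))
      ((𝔇 k).𝒦 Z t).Γ₀ ((𝔇 k).𝒦 Z t).C ((𝔇 k).𝒦 Z t).locΛ ((𝔇 k).𝒦 Z t).locN kap KG KΓ KCs KC)
  (hL16 : ∀ (k : ℕ) (Z : (domSys (F.P K) M (k + 1)).Dom), ∀ φ ∈ big (k + 1) Z, ∀ t ∈ terms L M Z,
    Differences216 c (fun σ => ((𝔇 k).𝒦 Z t).A2 σ ((𝔇 k).uOf Z t φ)) (fun σ => ((𝔇 k).𝒦 Z t).G2 σ ((𝔇 k).uOf Z t φ))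
      ((𝔇 k).𝒦 Z t).Γ₀ ((𝔇 k).𝒦 Z t).C ((𝔇 k).𝒦 Z t).locΛ ((𝔇 k).𝒦 Z t).locN kap θΓ θC θE)
  (hsmallKθ : ∀ (k : ℕ) (Z : (domSys (F.P K) M (k + 1)).Dom) (t : TermLabel (F.P K) M k L),
    KC * ((((𝔇 k).𝒦 Z t).m : ℝ) * (1 + 2 / kap) ^ (𝔇 k).ν) * (θ * ((((𝔇 k).𝒦 Z t).m : ℝ) * (1 + 2 / kap'') ^ (𝔇 k).ν)) < 1)
  -- the (2.24)–(2.25) smallness per term, uniform constants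
  {cE gq : ℝ} (hc0 : 0 ≤ cE)
  (hc : ∀ (k : ℕ) (Z : (domSys (F.P K) M (k + 1)).Dom) (t : TermLabel (F.P K) M k L) (i : ((𝔇 k).𝒦 Z t).Λ),
    ((𝔇 k).𝒦 Z t).hC.1.eigenvalues i ≤ cE)
  (hαc : ∀ (k : ℕ) (Z : (domSys (F.P K) M (k + 1)).Dom) (t : TermLabel (F.P K) M k L),
    (2 * (θ * ((((𝔇 k).𝒦 Z t).m : ℝ) * (1 + 2 / kap'') ^ (𝔇 k).ν)) + (γ₂ + a₂₀)) * cE ≤ 1 / 2)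
  (hg : 0 ≤ gq)
  (hΓq : ∀ (k : ℕ) (Z : (domSys (F.P K) M (k + 1)).Dom) (t : TermLabel (F.P K) M k L) (X : ((𝔇 k).𝒦 Z t).Λ ⊕ ((𝔇 k).𝒦 Z t).C₀ → ℝ),
    (((𝔇 k).𝒦 Z t).Γ₀ *ᵥ X) ⬝ᵥ (((𝔇 k).𝒦 Z t).C *ᵥ (((𝔇 k).𝒦 Z t).Γ₀ *ᵥ X)) ≤ gq * (X ⬝ᵥ X))
  (hsm25 : ∀ (k : ℕ) (Z : (domSys (F.P K) M (k + 1)).Dom) (t : TermLabel (F.P K) M k L),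
    (2 * (θ * ((((𝔇 k).𝒦 Z t).m : ℝ) * (1 + 2 / kap'') ^ (𝔇 k).ν)) + (γ₂ + a₂₀)) * (1 + 2 * cE * gq) ≤ 1 / 2)
  -- constant matching, [II] p. 17: the |P|-rate of the weights and «exp O(1)α₅|Z|»
  {a a₅ : ℝ} (hPa : a ≤ γ₂ * rP ^ 2)
  (hvol : ∀ (k : ℕ) (Z : (domSys (F.P K) M (k + 1)).Dom) (t : TermLabel (F.P K) M k L),
    2 * (KC * ((((𝔇 k).𝒦 Z t).m : ℝ) * (1 + 2 / kap) ^ (𝔇 k).ν) * (θ * ((((𝔇 k).𝒦 Z t).m : ℝ) * (1 + 2 / kap'') ^ (𝔇 k).ν))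
            * (1 + (1 - KC * ((((𝔇 k).𝒦 Z t).m : ℝ) * (1 + 2 / kap) ^ (𝔇 k).ν)
              * (θ * ((((𝔇 k).𝒦 Z t).m : ℝ) * (1 + 2 / kap'') ^ (𝔇 k).ν)))⁻¹) / 2)
        * (Fintype.card ((𝔇 k).𝒦 Z t).Λ : ℝ)
      + w + (2 * (θ * ((((𝔇 k).𝒦 Z t).m : ℝ) * (1 + 2 / kap'') ^ (𝔇 k).ν)) + (γ₂ + a₂₀)) * cE * (Fintype.card ((𝔇 k).𝒦 Z t).Λ : ℝ)
      + (2 * (θ * ((((𝔇 k).𝒦 Z t).m : ℝ) * (1 + 2 / kap'') ^ (𝔇 k).ν)) + (γ₂ + a₂₀)) * (1 + 2 * cE * gq)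
        * (Fintype.card (((𝔇 k).𝒦 Z t).Λ ⊕ ((𝔇 k).𝒦 Z t).C₀) : ℝ)
      ≤ a₅ * ((Z.1).card : ℝ))

include hκ₁ hα₆ hpos hhalf hUσ hUτ hUexp hUtau hr hr' hsubτ hχ0 hχc0 hΨσ hΨτ hAs hA hγ₂ ha0 hqP h222 h220R hfibN hkap'' h1 h2 hθE hθΓ hθC hKG
  hKΓ hKCs hKC hθEle hθΓle hθR1le hL17 hL16 hsmallKθ hc0 hc hαc hg hΓq hsm25 hPa hvol

/-! ## §1 (T-226) for the datum's term functional along the history, from the located inputs -/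

/-- **★ (T-226) FOR `𝔇.TF` ALONG THE HISTORY, FROM THE LOCATED INPUTS**: for every step `k`, every coupling `g ∈ D`, every older-term table in the class
«(1.18)`(E₀,r₁)` on the tables `sp j` + analytic there», every `Z ∈ 𝐃_{k+1}`, every configuration `φ` of the located-inputs table `big (k+1) Z` and every term
`(𝐃,P) ∈ terms L M Z`: `‖𝔇.TF k Z (𝐃,P) g old φ‖ ≤ weight L M c Z a (𝐃,P) · e^{a₅|Z|}` — W1's `TermDatum214.norm_TF_le_weight_of_primitives` applied once per term.
[cite: Balaban1988RG2Cluster, (2.26) p.17, (2.14) p.15, (2.16)-(2.22) p.16, (2.23)-(2.25) p.17, (1.41) p.11] -/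
theorem termwise226_TF_of_located :
    ∀ k : ℕ, ∀ s ∈ D, ∀ old : OlderTerms (F.P K) 𝔸 M k,
      (∀ (j : Fin (k + 1)) (Y : (domSys (F.P K) M j).Dom), ∀ ψ ∈ sp j Y,
          ‖old j Y ψ‖ ≤ E₀ * Real.exp (-(r₁ * (domSys (F.P K) M j).dj Y))) →
      (∀ (j : Fin (k + 1)) (Y : (domSys (F.P K) M j).Dom), AnalyticOnNhd ℂ (old j Y) (sp j Y)) →
      ∀ (Z : (domSys (F.P K) M (k + 1)).Dom) (φ : CPair (F.P K) 𝔸), φ ∈ big (k + 1) Z → ∀ t ∈ terms L M Z,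
        ‖𝔇.TF k Z t s old φ‖ ≤ weight L M c Z a t * Real.exp (a₅ * ((Z.1).card : ℝ)) := by
  intro k s hs old hB hAn Z φ hφ t ht
  have h17 := hL17 k Z φ hφ t ht
  have h16 := hL16 k Z φ hφ t ht
  rw [TermData214.TF_apply]
  exact (𝔇 k).norm_TF_le_weight_of_primitives hκ₁ hα₆ Z t s old φ (hpos k) (hhalf k) hUσ hUτ hUexp (hUtau k) (hr k) (hr' k)
    (hsubτ k) (hχ0 k Z t s hs) (hχc0 k Z t s hs) (hΨσ k s hs old hB hAn Z φ hφ t ht) (hΨτ k s hs old hB hAn Z φ hφ t ht)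
    (hAs k Z φ hφ t ht) (hA k Z φ hφ t ht) (qP k Z t) (h222 k Z t s hs) hγ₂ (hqP k Z t) (h220R k s hs old hB hAn Z φ hφ t ht) ha0
    (hfibN k Z t) hkap'' h1 h2 hθE hθΓ hθC hKG hKΓ hKCs hKC hθEle hθΓle (hθR1le k Z t) h17.hG h17.hΓ₀
    (fun σ hσ => by simpa only [TermDatum214.A_apply] using h17.hCs σ hσ) h17.hC216 h16.hdΓ
    (fun σ hσ => by simpa only [TermDatum214.A_apply] using h16.hdC σ hσ)
    (fun σ hσ => by simpa only [TermDatum214.A_apply] using h16.hdE σ hσ)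
    (hsmallKθ k Z t) hc0 (hc k Z t) (hαc k Z t) hg (hΓq k Z t) (hsm25 k Z t) hPa (hvol k Z t)

/-! ## §2 Files 23 ∕ 24 at the generator `𝔇.Gn = GenTower.ofTerms L 𝔇.TF`: (T-an) is the one remaining analytic binder -/

/-- **(GEN) AT THE DATUM's GENERATOR `𝔇.Gn`** (file 23 `stepGen_ofTerms_of_termwise` with `hT226 :=` §1; the step's table inside the located-inputs table):
for every step, every `g ∈ D` and every admissible older-term table the activities `(𝔇.Gn k).H g old · Z` are analytic at the points of `sp (k+1) Z` and
(2.38)-bounded there with `A = C₃ε₁`, `R = (1−8δ)·½L·κ`. [cite: Balaban1988RG2Cluster, (2.14) p.15, (2.26) p.17 and Lemma 3 (2.38) p.20] -/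
theorem stepGen_Gn_of_located (hL8 : 8 ≤ c.L) (hLc : c.L = L) {a₂ a₂' Aabs : ℝ} (hN : Lemma3Numerics c M ((c.L : ℝ) / 2) a a₂ a₂' a₅ Aabs)
    (hbig : ∀ (k : ℕ) (Z : (domSys (F.P K) M (k + 1)).Dom), sp (k + 1) Z ⊆ big (k + 1) Z)
    (hTan : ∀ k : ℕ, ∀ s ∈ D, ∀ old : OlderTerms (F.P K) 𝔸 M k,
      (∀ (j : Fin (k + 1)) (Y : (domSys (F.P K) M j).Dom), ∀ ψ ∈ sp j Y,
          ‖old j Y ψ‖ ≤ E₀ * Real.exp (-(r₁ * (domSys (F.P K) M j).dj Y))) →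
      (∀ (j : Fin (k + 1)) (Y : (domSys (F.P K) M j).Dom), AnalyticOnNhd ℂ (old j Y) (sp j Y)) →
      ∀ (Z : (domSys (F.P K) M (k + 1)).Dom), ∀ t ∈ terms L M Z, AnalyticOnNhd ℂ (fun φ => (𝔇 k).TF Z t s old φ) (sp (k + 1) Z)) :
    ∀ k : ℕ, ∀ s ∈ D, ∀ old : OlderTerms (F.P K) 𝔸 M k,
      (∀ (j : Fin (k + 1)) (Y : (domSys (F.P K) M j).Dom), ∀ ψ ∈ sp j Y,
          ‖old j Y ψ‖ ≤ E₀ * Real.exp (-(r₁ * (domSys (F.P K) M j).dj Y))) →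
      (∀ (j : Fin (k + 1)) (Y : (domSys (F.P K) M j).Dom), AnalyticOnNhd ℂ (old j Y) (sp j Y)) →
      (∀ Z : (domSys (F.P K) M (k + 1)).Dom, AnalyticOnNhd ℂ (fun φ => (𝔇.Gn k).H s old φ Z) (sp (k + 1) Z)) ∧
      (∀ (Z : (domSys (F.P K) M (k + 1)).Dom), ∀ φ ∈ sp (k + 1) Z,
          ‖(𝔇.Gn k).H s old φ Z‖ ≤
            c.C3act * c.ε₁ * Real.exp (-((1 - 8 * c.δ) * ((c.L : ℝ) / 2) * c.κ * (domSys (F.P K) M (k + 1)).dj Z))) :=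
  stepGen_ofTerms_of_termwise F K L 𝔇.TF D sp c hL8 hLc hN hTan fun k s hs old hB hAn Z φ hφ t ht =>
    termwise226_TF_of_located F K L 𝔇 D sp big hκ₁ hα₆ hpos hhalf hUσ hUτ hUexp hUtau hr hr' hsubτ hχ0 hχc0 hΨσ hΨτ hAs hA hγ₂ ha0 qP
      hqP h222 h220R hfibN hkap'' h1 h2 hθE hθΓ hθC hKG hKΓ hKCs hKC hθEle hθΓle hθR1le hL17 hL16 hsmallKθ hc0 hc hαc hg hΓq hsm25 hPa hvol
      k s hs old hB hAn Z φ (hbig k Z hφ) t ht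

/-- **W1's `RecAdmissible` FOR THE DATUM's GENERATOR** (file 23 `recAdmissible_ofTerms_of_termwise` with `hT226 :=` §1): along every history with values in `D`
the generated older terms lie in the class «(1.18)`(E₀,r₁)` on the tables + analytic there» — THE INDUCTION CLOSES: that class is the guard of Lemma 2's (2.20)
input `h220R`. [cite: Balaban1987RG1, (1.18) p.263 and Thm 1 p.259; Balaban1988RG2Cluster, (1.41) p.11, (2.14) p.15, (2.26) p.17, p.22] -/
theorem recAdmissible_Gn_of_located (hrestr : ∀ k, W1.SpRestr (sp (k + 1))) (hL8 : 8 ≤ c.L) (hLc : c.L = L) {a₂ a₂' Aabs : ℝ}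
    (hN : Lemma3Numerics c M ((c.L : ℝ) / 2) a a₂ a₂' a₅ Aabs)
    (hbig : ∀ (k : ℕ) (Z : (domSys (F.P K) M (k + 1)).Dom), sp (k + 1) Z ⊆ big (k + 1) Z)
    (hTan : ∀ k : ℕ, ∀ s ∈ D, ∀ old : OlderTerms (F.P K) 𝔸 M k,
      (∀ (j : Fin (k + 1)) (Y : (domSys (F.P K) M j).Dom), ∀ ψ ∈ sp j Y,
          ‖old j Y ψ‖ ≤ E₀ * Real.exp (-(r₁ * (domSys (F.P K) M j).dj Y))) →
      (∀ (j : Fin (k + 1)) (Y : (domSys (F.P K) M j).Dom), AnalyticOnNhd ℂ (old j Y) (sp j Y)) →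
      ∀ (Z : (domSys (F.P K) M (k + 1)).Dom), ∀ t ∈ terms L M Z, AnalyticOnNhd ℂ (fun φ => (𝔇 k).TF Z t s old φ) (sp (k + 1) Z))
    (hr₁ : 0 ≤ r₁) (hApos : 0 ≤ c.C3act * c.ε₁) (hrate : r₁ + 2 * (64 * Real.log 162) + 2 ≤ (1 - 8 * c.δ) * ((c.L : ℝ) / 2) * c.κ)
    (hKP : c.C3act * c.ε₁ * Real.exp (5 * r₁ + 1) * K₀ 64 8 * 9 * 64 < 1)
    (hrenew : Real.exp 1 * 9 * 64 * K₀ 64 8 ^ 2 * (c.C3act * c.ε₁) ≤ E₀) :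
    RecAdmissible 𝔇.Gn D fun k => {old : OlderTerms (F.P K) 𝔸 M k |
      (∀ (j : Fin (k + 1)) (Y : (domSys (F.P K) M j).Dom), ∀ ψ ∈ sp j Y,
          ‖old j Y ψ‖ ≤ E₀ * Real.exp (-(r₁ * (domSys (F.P K) M j).dj Y))) ∧
      (∀ (j : Fin (k + 1)) (Y : (domSys (F.P K) M j).Dom), AnalyticOnNhd ℂ (old j Y) (sp j Y))} :=
  recAdmissible_ofTerms_of_termwise F K L 𝔇.TF D sp hrestr c hL8 hLc hN hTan (fun k s hs old hB hAn Z φ hφ t ht =>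
    termwise226_TF_of_located F K L 𝔇 D sp big hκ₁ hα₆ hpos hhalf hUσ hUτ hUexp hUtau hr hr' hsubτ hχ0 hχc0 hΨσ hΨτ hAs hA hγ₂ ha0 qP
      hqP h222 h220R hfibN hkap'' h1 h2 hθE hθΓ hθC hKG hKΓ hKCs hKC hθEle hθΓle hθR1le hL17 hL16 hsmallKθ hc0 hc hαc hg hΓq hsm25 hPa hvol
      k s hs old hB hAn Z φ (hbig k Z hφ) t ht) hr₁ hApos hrate hKP hrenew

/-- **THE (2.38) PAIR AT EVERY STEP OF `toClusterTower 𝔇.Gn`** on the boxes `]0, γ]^{k+1}` read inside `D` (file 23 `hLayer_toClusterTower_ofTerms_of_termwise`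
with `hT226 :=` §1) — the per-step H-layer hypotheses of files 9–13 and of dag-n18-d's junctions, at the datum. [cite: Balaban1988RG2Cluster, (2.14) p.15, (2.26) p.17, Lemma 3 (2.38) p.20; Balaban1987RG1, Thm 1 p.259] -/
theorem hLayer_toClusterTower_Gn_of_located {γ : ℝ} (hrestr : ∀ k, W1.SpRestr (sp (k + 1))) (hL8 : 8 ≤ c.L) (hLc : c.L = L)
    {a₂ a₂' Aabs : ℝ} (hN : Lemma3Numerics c M ((c.L : ℝ) / 2) a a₂ a₂' a₅ Aabs)
    (hbig : ∀ (k : ℕ) (Z : (domSys (F.P K) M (k + 1)).Dom), sp (k + 1) Z ⊆ big (k + 1) Z)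
    (hTan : ∀ k : ℕ, ∀ s ∈ D, ∀ old : OlderTerms (F.P K) 𝔸 M k,
      (∀ (j : Fin (k + 1)) (Y : (domSys (F.P K) M j).Dom), ∀ ψ ∈ sp j Y,
          ‖old j Y ψ‖ ≤ E₀ * Real.exp (-(r₁ * (domSys (F.P K) M j).dj Y))) →
      (∀ (j : Fin (k + 1)) (Y : (domSys (F.P K) M j).Dom), AnalyticOnNhd ℂ (old j Y) (sp j Y)) →
      ∀ (Z : (domSys (F.P K) M (k + 1)).Dom), ∀ t ∈ terms L M Z, AnalyticOnNhd ℂ (fun φ => (𝔇 k).TF Z t s old φ) (sp (k + 1) Z))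
    (hr₁ : 0 ≤ r₁) (hApos : 0 ≤ c.C3act * c.ε₁) (hrate : r₁ + 2 * (64 * Real.log 162) + 2 ≤ (1 - 8 * c.δ) * ((c.L : ℝ) / 2) * c.κ)
    (hKP : c.C3act * c.ε₁ * Real.exp (5 * r₁ + 1) * K₀ 64 8 * 9 * 64 < 1)
    (hrenew : Real.exp 1 * 9 * 64 * K₀ 64 8 ^ 2 * (c.C3act * c.ε₁) ≤ E₀) (hD : ∀ s ∈ Ioc (0 : ℝ) γ, ((s : ℝ) : ℂ) ∈ D) :
    ∀ k, (toClusterTower 𝔇.Gn k).AnalyticH (box γ k) (sp (k + 1)) ∧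
      (toClusterTower 𝔇.Gn k).Bound238 (box γ k) (sp (k + 1)) (c.C3act * c.ε₁) ((1 - 8 * c.δ) * ((c.L : ℝ) / 2) * c.κ) :=
  hLayer_toClusterTower_ofTerms_of_termwise F K L 𝔇.TF D sp hrestr c hL8 hLc hN hTan (fun k s hs old hB hAn Z φ hφ t ht =>
    termwise226_TF_of_located F K L 𝔇 D sp big hκ₁ hα₆ hpos hhalf hUσ hUτ hUexp hUtau hr hr' hsubτ hχ0 hχc0 hΨσ hΨτ hAs hA hγ₂ ha0 qP
      hqP h222 h220R hfibN hkap'' h1 h2 hθE hθΓ hθC hKG hKΓ hKCs hKC hθEle hθΓle hθR1le hL17 hL16 hsmallKθ hc0 hc hαc hg hΓq hsm25 hPa hvol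
      k s hs old hB hAn Z φ (hbig k Z hφ) t ht) hr₁ hApos hrate hKP hrenew hD

/-- **(1.18) FOR THE GENERATED TOWER OF THE DATUM** on every history set read inside `D` (file 23 `termBound118_toClusterTower_ofTerms_of_termwise` with
`hT226 :=` §1). [cite: Balaban1987RG1, (1.18) p.263 and Thm 1 p.259; Balaban1988RG2Cluster, (2.26) p.17, (2.41) p.21 and p.22] -/
theorem termBound118_toClusterTower_Gn_of_located (hrestr : ∀ k, W1.SpRestr (sp (k + 1))) (hL8 : 8 ≤ c.L) (hLc : c.L = L)
    {a₂ a₂' Aabs : ℝ} (hN : Lemma3Numerics c M ((c.L : ℝ) / 2) a a₂ a₂' a₅ Aabs)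
    (hbig : ∀ (k : ℕ) (Z : (domSys (F.P K) M (k + 1)).Dom), sp (k + 1) Z ⊆ big (k + 1) Z)
    (hTan : ∀ k : ℕ, ∀ s ∈ D, ∀ old : OlderTerms (F.P K) 𝔸 M k,
      (∀ (j : Fin (k + 1)) (Y : (domSys (F.P K) M j).Dom), ∀ ψ ∈ sp j Y,
          ‖old j Y ψ‖ ≤ E₀ * Real.exp (-(r₁ * (domSys (F.P K) M j).dj Y))) →
      (∀ (j : Fin (k + 1)) (Y : (domSys (F.P K) M j).Dom), AnalyticOnNhd ℂ (old j Y) (sp j Y)) →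
      ∀ (Z : (domSys (F.P K) M (k + 1)).Dom), ∀ t ∈ terms L M Z, AnalyticOnNhd ℂ (fun φ => (𝔇 k).TF Z t s old φ) (sp (k + 1) Z))
    (hr₁ : 0 ≤ r₁) (hApos : 0 ≤ c.C3act * c.ε₁) (hrate : r₁ + 2 * (64 * Real.log 162) + 2 ≤ (1 - 8 * c.δ) * ((c.L : ℝ) / 2) * c.κ)
    (hKP : c.C3act * c.ε₁ * Real.exp (5 * r₁ + 1) * K₀ 64 8 * 9 * 64 < 1)
    (hrenew : Real.exp 1 * 9 * 64 * K₀ 64 8 ^ 2 * (c.C3act * c.ε₁) ≤ E₀) (W : Set (ℕ → ℝ)) (hW : ∀ g ∈ W, ∀ n, ((g n : ℝ) : ℂ) ∈ D) :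
    TermBound118 (toClusterTower 𝔇.Gn) W sp E₀ r₁ :=
  termBound118_toClusterTower_ofTerms_of_termwise F K L 𝔇.TF D sp hrestr c hL8 hLc hN hTan (fun k s hs old hB hAn Z φ hφ t ht =>
    termwise226_TF_of_located F K L 𝔇 D sp big hκ₁ hα₆ hpos hhalf hUσ hUτ hUexp hUtau hr hr' hsubτ hχ0 hχc0 hΨσ hΨτ hAs hA hγ₂ ha0 qP
      hqP h222 h220R hfibN hkap'' h1 h2 hθE hθΓ hθC hKG hKΓ hKCs hKC hθEle hθΓle hθR1le hL17 hL16 hsmallKθ hc0 hc hαc hg hΓq hsm25 hPa hvol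
      k s hs old hB hAn Z φ (hbig k Z hφ) t ht) hr₁ hApos hrate hKP hrenew W hW

/-- **W1's `RecAdmissible` ON `sp` FOR THE DATUM's GENERATOR ON PRINT's TABLE PAIR** (file 24 `recAdmissible_ofTerms_of_termwise₂` with `hT226 :=` §1):
older terms read on `sp`, the step's (T-an) on the LARGER table `sp′` inside the located-inputs table, the clause `Z ⊆ X ⇒ sp X ⊆ sp′ Z` ([II] p. 15: restrict
through the (i)–(iii)-space with larger radii). [cite: Balaban1988RG2Cluster, p.15, (2.14) p.15, (2.26) p.17; Balaban1987RG1, (1.18) p.263 and Thm 1 p.259] -/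
theorem recAdmissible_Gn_of_located₂ (sp' : (j : ℕ) → (domSys (F.P K) M j).Dom → Set (CPair (F.P K) 𝔸))
    (hrestr : ∀ k, ∀ X Z : (domSys (F.P K) M (k + 1)).Dom, Z.1 ⊆ X.1 → sp (k + 1) X ⊆ sp' (k + 1) Z) (hL8 : 8 ≤ c.L) (hLc : c.L = L)
    {a₂ a₂' Aabs : ℝ} (hN : Lemma3Numerics c M ((c.L : ℝ) / 2) a a₂ a₂' a₅ Aabs)
    (hbig : ∀ (k : ℕ) (Z : (domSys (F.P K) M (k + 1)).Dom), sp' (k + 1) Z ⊆ big (k + 1) Z)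
    (hTan : ∀ k : ℕ, ∀ s ∈ D, ∀ old : OlderTerms (F.P K) 𝔸 M k,
      (∀ (j : Fin (k + 1)) (Y : (domSys (F.P K) M j).Dom), ∀ ψ ∈ sp j Y,
          ‖old j Y ψ‖ ≤ E₀ * Real.exp (-(r₁ * (domSys (F.P K) M j).dj Y))) →
      (∀ (j : Fin (k + 1)) (Y : (domSys (F.P K) M j).Dom), AnalyticOnNhd ℂ (old j Y) (sp j Y)) →
      ∀ (Z : (domSys (F.P K) M (k + 1)).Dom), ∀ t ∈ terms L M Z, AnalyticOnNhd ℂ (fun φ => (𝔇 k).TF Z t s old φ) (sp' (k + 1) Z))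
    (hr₁ : 0 ≤ r₁) (hApos : 0 ≤ c.C3act * c.ε₁) (hrate : r₁ + 2 * (64 * Real.log 162) + 2 ≤ (1 - 8 * c.δ) * ((c.L : ℝ) / 2) * c.κ)
    (hKP : c.C3act * c.ε₁ * Real.exp (5 * r₁ + 1) * K₀ 64 8 * 9 * 64 < 1)
    (hrenew : Real.exp 1 * 9 * 64 * K₀ 64 8 ^ 2 * (c.C3act * c.ε₁) ≤ E₀) :
    RecAdmissible 𝔇.Gn D fun k => {old : OlderTerms (F.P K) 𝔸 M k |
      (∀ (j : Fin (k + 1)) (Y : (domSys (F.P K) M j).Dom), ∀ ψ ∈ sp j Y,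
          ‖old j Y ψ‖ ≤ E₀ * Real.exp (-(r₁ * (domSys (F.P K) M j).dj Y))) ∧
      (∀ (j : Fin (k + 1)) (Y : (domSys (F.P K) M j).Dom), AnalyticOnNhd ℂ (old j Y) (sp j Y))} :=
  recAdmissible_ofTerms_of_termwise₂ F K L 𝔇.TF D sp sp' hrestr c hL8 hLc hN hTan (fun k s hs old hB hAn Z φ hφ t ht =>
    termwise226_TF_of_located F K L 𝔇 D sp big hκ₁ hα₆ hpos hhalf hUσ hUτ hUexp hUtau hr hr' hsubτ hχ0 hχc0 hΨσ hΨτ hAs hA hγ₂ ha0 qP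
      hqP h222 h220R hfibN hkap'' h1 h2 hθE hθΓ hθC hKG hKΓ hKCs hKC hθEle hθΓle hθR1le hL17 hL16 hsmallKθ hc0 hc hαc hg hΓq hsm25 hPa hvol
      k s hs old hB hAn Z φ (hbig k Z hφ) t ht) hr₁ hApos hrate hKP hrenew

end Located

end Summit.QuantumFields.YangMills.BalabanUVNodes.N18HLayerW1TermDatum

end
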